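import Literature.AlgebraicGeometry.Motives.TateAbelianFiniteEndAlgebraProofs
import Literature.AlgebraicGeometry.Motives.FaltingsAbelianMumford19Proofs
import Literature.NumberTheory.DiophantineGeometry.AVIsogenyTateHomCubeProofs
import HarnessLib

/-!
# Tate 1966 over a finite field (and Faltings 1983, §5): the trust base after the Theorem of the Cube

Fourth pure-proof sibling of `Literature.AlgebraicGeometry.Motives.TateAbelianFinite` (after
`TateAbelianFiniteProofs`, `TateAbelianFiniteAssemblyProofs`, `TateAbelianFiniteEndAlgebraProofs`,
and the `End`-form files `TateAbelianFiniteEndProofs`, `AbelianVarietyEndAlgebraSemisimpleProofs`).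

The named facts

* `tate_end_bijective_of_finite A ℓ` — J. Tate, *Endomorphisms of abelian varieties over finite
  fields*, Invent. Math. 2 (1966), Main Theorem (`End` form): for `K` finite and `ℓ ≠ char K`,
  `ℤ_ℓ ⊗ End_K(A) → End_{Γ_K}(T_ℓ A)` is bijective;
* `tate_bijective_of_finite A B ℓ` — the same for `ℤ_ℓ ⊗ Hom_K(A, B) → Hom_{Γ_K}(T_ℓ A, T_ℓ B)`,

were assembled in `tate_end_bijective_of_finite_of_mumford19` /
`tate_bijective_of_finite_of_mumford19` from the two finite-field inputs of Tate's proof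
(`finite_isoClasses_of_finite`, Milne 1986 Cor. 18.9; `exists_quotient_isogeny`, Mumford §7
Thm. 4) and *seven* inputs from Mumford §6/§19: `[n]_X` an isogeny (`h₀`), Poincaré's complete
reducibility theorem (`hP1`, §19 Thm. 1), "non-zero homomorphisms of simple abelian varieties are
isogenies" (`hsimple`, §19 proof of Cor. 2 of Thm. 1), the degree theorem (`hdeg`, §19 Thm. 2)
and the torsion counts `#X[n](K̄) = n^{2 dim X}` (`hA`, `hB`, §6 Prop. p. 64).

Since then the tree has proved, from the **Theorem of the Cube** (`theoremOfCube_linEquiv`,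
Görtz–Wedhorn II, Thm. 24.73) alone: `[n]_X` is an isogeny
(`isIsogeny_zsmul_id_of_theoremOfCube_linEquiv`, `Motives/AbelianVarietyTorsionCubeProofs`), its
degree is `n^{2g}` and `#X[n](K̄) = n^{2g}` (`kerRank_zsmul_id_of_theoremOfCube_linEquiv`,
`natCard_torsionPoints_of_isAlgClosed_of_theoremOfCube_linEquiv`), and the consumed part of the
degree theorem (`kerRank_sum_le_of_theoremOfCube`, `Motives/AbelianVarietyEndDegreeBound`), whence
Mumford §19 Thm. 3 in the form `module_finite_hom_of_theoremOfCube_of_poincare hcube hP1 hsimple A B`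
(`NumberTheory/DiophantineGeometry/AVIsogenyTateFinrankHomCubeProofs`); and the Theorem of the Cube
itself from the pseudo-coherence of the Čech complex of `𝒪(D)`
(`theoremOfCube_linEquiv_of_pseudoCoherent_general`, `Motives/AbelianVarietyTheoremOfCubeProofs`;
the named fact `cechComplex_pseudoCoherent_general`, Görtz–Wedhorn II, Thm. 23.133 / Cor. 23.135 —
the finiteness theorem for the coherent cohomology of proper morphisms, in Čech form).

This file records the resulting assemblies, so that the trust base of Tate's theorem in this tree
is visible in one statement each:

* `tate_end_bijective_of_finite_of_theoremOfCube_of_poincare`,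
  `tate_bijective_of_finite_of_theoremOfCube_of_poincare`: Tate's Main Theorem (`End` and `Hom`
  forms) from `theoremOfCube_linEquiv`, `hP1`, `hsimple`, `finite_isoClasses_of_finite K (dim P)`
  and `exists_quotient_isogeny P ℓ` for `P = A ⊞ A`, resp. `P = A ⊞ B`;
* `…_of_pseudoCoherent_general_of_poincare`: the same with the Theorem of the Cube replaced by
  `cechComplex_pseudoCoherent_general` — **the current trust base: three named facts
  (`cechComplex_pseudoCoherent_general`, `finite_isoClasses_of_finite`, `exists_quotient_isogeny`)
  and the two printed statements of Mumford §19 (`hP1`, `hsimple`)**; granted their discharges,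
  `tate_end_bijective_of_finite_holds` / `tate_bijective_of_finite_holds` are these theorems
  applied to them;
* `…_of_theoremOfCube_of_isogeny_biprod`: the variants with Poincaré's theorem in the two-sided
  splitting form `hP` (isogenies `X₁ ⊞ X₂ ⇄ X` for non-simple `X`; §19 Thm. 1 with Cor. 1) used by
  `module_finite_hom_of_theoremOfCube_of_isogeny_biprod` and
  `isSemisimpleRing_endAlgebra_of_poincare`;
* `tate_bijective_of_finite_of_forall_theoremOfCube_of_poincare`: the `Hom` form for all pairs
  from the global forms `∀ g, finite_isoClasses_of_finite K g`, `∀ P, exists_quotient_isogeny P ℓ`;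
* the number-field counterparts (Faltings 1983, §5: Satz 4, Korollar 1, Satz 3, Korollar 2) from
  Finiteness I (`finite_isoClasses_isogenous`), quotients, the Theorem of the Cube, `hP1` and
  `hsimple`: `faltings_tate_end_bijective_of_finitenessI_of_theoremOfCube_of_poincare`,
  `faltings_tate_bijective_of_finitenessI_of_theoremOfCube_of_poincare`,
  `isSemisimpleRepresentation_rationalTateRep_of_finitenessI_of_theoremOfCube_of_poincare`,
  `isIsogenous_iff_nonempty_equiv_rationalTateRep_of_finitenessI_of_theoremOfCube_of_poincare`
  (removing `hdeg`, `hA`, `hB` from the `…_of_finitenessI_of_mumford19` assemblies of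
  `FaltingsAbelianMumford19Proofs`).

* **Tate's method over an arbitrary perfect field** (last section):
  `faltingsTateMap_bijective_of_exists_infinite_iso` — for `K` perfect, `(ℓ : K) ≠ 0` and a
  bicone `b` on `(A, B)` (e.g. `A ⊞ B`), the Tate map `ℤ_ℓ ⊗ Hom_K(A, B) → Hom_{Γ_K}(T_ℓ A, T_ℓ B)`
  is bijective as soon as (∞-iso) *in every sequence of abelian varieties over `K` isogenous to
  `b.pt` infinitely many terms are mutually isomorphic*, `b.pt` admits quotients by finite stable
  `ℓ`-power subgroups, `End⁰(b.pt)` is finite-dimensional and semisimple, and the Tate map is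
  injective. This is the field-agnostic content of Tate's paper (§§1–3: the Main Theorem follows
  from a finiteness hypothesis on the isogeny class of `A × B`; Milne, *Abelian Varieties* (2008),
  Ch. IV, Lemma 2.4 and Thm. 2.5, where Finiteness I ⇒ semisimplicity and the Tate conjecture is
  proved for any field over which Finiteness I is known), assembled from the tree's perfect-field
  lattice lemma `tateSubspaceRealization_of_exists_infinite_iso`, the double-centraliser step
  `mem_span_rationalTateModuleMap_of_tateSubspaceRealization`, Milne's Lemma 12.6 and
  `faltingsTateMap_surjective_of_span_of_saturated`. Both vendored facts are specialisations:
  over a finite field (∞-iso) is the pigeonhole consequence of `finite_isoClasses_of_finite`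
  (`exists_infinite_iso_of_finite_isoClasses_of_finite(_of_isIsogenous)`), giving
  `tate_bijective_of_finite_of_exists_infinite_iso` / `tate_end_bijective_of_finite_of_exists_infinite_iso`
  — the named facts from finiteness of isomorphism classes **within the isogeny class of `A ⊞ B`
  (resp. `A ⊞ A`) only** — and their `…_of_theoremOfCube_of_poincare` forms; over a number field
  (∞-iso) is `finite_isoClasses_isogenous.exists_infinite_setOf_iso` (Finiteness I).

In each case the proof is: `End_K(P)` finitely generated by
`module_finite_hom_of_theoremOfCube_of_poincare` (Mumford §19 Thm. 3), hence `End⁰(P)`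
finite-dimensional and the Tate map injective (`finiteDimensional_endAlgebra_of_module_finite_hom`,
`faltingsTateMap_injective_of_module_finite_hom`, Milne 1986 Thm. 12.5); `End⁰(P)` semisimple by
`isSemisimpleRing_endAlgebra_of_mumford19 hP1 hsimple` (Mumford §19 Cor. 2 of Thm. 1, proved in
`AbelianVarietyEndAlgebraSemisimpleProofs`); conclude by the `…_of_endAlgebra` /
`…_of_endAlgebra_of_module_finite_hom` assemblies (lattice lemma, graph commutation, Jacobson
density, Milne's Lemma 12.6 — all theorems of the tree).

No definition, no named fact, no `_holds` (D-0026): the five residual inputs are owned elsewhere.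

## References

* [Tate1966Endomorphisms] J. Tate, *Endomorphisms of abelian varieties over finite fields*,
  Invent. Math. 2 (1966), 134–144, Main Theorem. Not held (doi:10.1007/bf01404549); statement and
  architecture as reported in [Milne, *The Work of John Tate*, §4.3, 4.3.1 (arXiv:1210.7459,
  pp. 22–23, held, read)] and [Kieffer2024IsogenyGraphs, Thm. 1.2.11 and §1.2.4 (pp. 26–32, held,
  read)].
* [MumfordAV1970] D. Mumford, *Abelian Varieties* (1970), §19 Thm. 1 (p. 173), Cor. 2 of Thm. 1
  (p. 174), Thm. 2, Thm. 3 (pp. 176–178); §7 Thm. 4 (p. 72); §6 App. 2–3, Prop. p. 64.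
* [Milne1986AbelianVarieties] J. S. Milne, *Abelian Varieties*, in Cornell–Silverman (1986),
  Prop. 12.1, Thm. 12.5, Lemma 12.6, Cor. 18.9 (held: `book:cornellnd-arithmetic-geometry`).
* [MilneAV2008] J. S. Milne, *Abelian Varieties* (course notes, v2.00, 2008), Ch. IV, Lemma 2.4 and
  Thm. 2.5 (pp. 137–138): Finiteness I ⇒ the lattice lemma ⇒ semisimplicity and the Tate conjecture.
* [Faltings1983Endlichkeit] G. Faltings, *Endlichkeitssätze für abelsche Varietäten über
  Zahlkörpern*, Invent. Math. 73 (1983), §5 Satz 3, Satz 4, Korollar 1, Korollar 2.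
* [GortzWedhorn2023] U. Görtz, T. Wedhorn, *Algebraic Geometry II* (2023), Thm. 24.73 (p. 550),
  Thm. 23.133 / Cor. 23.135 (pp. 478–480).

## Design

Theorems only; `noncomputable section`; universe-monomorphic `K : Type u` (the cube facts are
universe-parametrised, `theoremOfCube_linEquiv.{u}`); hypotheses `hP1`, `hsimple`, `hP` spelled
exactly as in `AVIsogenyTateFinrankHomCubeProofs` / `AbelianVarietyEndAlgebraSemisimpleProofs`, so
that one term feeds all assemblies. One-line compositions.
-/

noncomputable section

universe u

open CategoryTheory CategoryTheory.Limits AlgebraicGeometry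

namespace Literature.AlgebraicGeometry.Motives

open AbelianVariety

variable {K : Type u} [Field K]

/-! ## Tate 1966 over a finite field -/

section Finite

variable (A B : AbelianVariety K) (ℓ : ℕ) [Fact ℓ.Prime]

/-- **Tate 1966, Main Theorem (`End` form), from the Theorem of the Cube, Poincaré's complete
reducibility theorem and "simple ⇒ isogeny".** For an abelian variety `A` over a field `K` and a
prime `ℓ`, the named fact `tate_end_bijective_of_finite A ℓ` (for `K` finite and `(ℓ : K) ≠ 0`,
`ℤ_ℓ ⊗ End_K(A) → End_{Γ_K}(T_ℓ A)` is bijective) follows from: the Theorem of the Cube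
(`hcube`, Görtz–Wedhorn II Thm. 24.73), Poincaré's theorem `hP1` (Mumford §19 Thm. 1), `hsimple`
(§19, proof of Cor. 2 of Thm. 1), finiteness of `K`-isomorphism classes in dimension `dim (A ⊞ A)`
(`hfin`, Milne 1986 Cor. 18.9) and quotients of `A ⊞ A` by finite stable `ℓ`-power subgroups
(`hq`, Mumford §7 Thm. 4). `End_K(A)` is finitely generated by
`module_finite_hom_of_theoremOfCube_of_poincare` (§19 Thm. 3), so `End⁰(A)` is finite-dimensional
and the Tate map is injective; `End⁰(A)` is semisimple by `isSemisimpleRing_endAlgebra_of_mumford19`;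
conclude by `tate_end_bijective_of_finite_of_endAlgebra`. [cite: Tate1966Endomorphisms, Main Theorem] -/
theorem tate_end_bijective_of_finite_of_theoremOfCube_of_poincare
    (hcube : theoremOfCube_linEquiv.{u})
    (hP1 : ∀ (X Y : AbelianVariety K) (i : Y ⟶ X), IsClosedImmersion (Hom.toSchemeHom i) →
      0 < Y.dim → Y.dim < X.dim →
      ∃ (Z : AbelianVariety K) (j : Z ⟶ X), IsClosedImmersion (Hom.toSchemeHom j) ∧
        IsIsogeny (biprod.desc i j))
    (hsimple : ∀ (X Y : AbelianVariety K), IsSimple X → IsSimple Y →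
      ∀ f : X ⟶ Y, f ≠ 0 → IsIsogeny f)
    (hfin : finite_isoClasses_of_finite K (A ⊞ A).dim) (hq : exists_quotient_isogeny (A ⊞ A) ℓ) :
    tate_end_bijective_of_finite A ℓ :=
  have hfg : module_finite_hom A A :=
    module_finite_hom_of_theoremOfCube_of_poincare hcube hP1 hsimple A A
  tate_end_bijective_of_finite_of_endAlgebra A ℓ hfin hq
    (finiteDimensional_endAlgebra_of_module_finite_hom A hfg)
    (isSemisimpleRing_endAlgebra_of_mumford19 hP1 hsimple A)
    (faltingsTateMap_injective_of_module_finite_hom A A hfg)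

/-- **Tate 1966, Main Theorem (`End` form) — the current trust base in this tree.**
`tate_end_bijective_of_finite A ℓ` follows from the pseudo-coherence of the Čech complex of
`𝒪(D)` (`h`, the named fact `cechComplex_pseudoCoherent_general`: Görtz–Wedhorn II, Thm. 23.133 /
Cor. 23.135, the finiteness theorem for the coherent cohomology of proper morphisms, which gives
the Theorem of the Cube by `theoremOfCube_linEquiv_of_pseudoCoherent_general`), Poincaré's theorem
`hP1`, `hsimple`, `finite_isoClasses_of_finite K (dim (A ⊞ A))` and
`exists_quotient_isogeny (A ⊞ A) ℓ`. Granted the discharges of the three named facts and proofs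
of `hP1`, `hsimple`, `tate_end_bijective_of_finite_holds` is this theorem applied to them.
[cite: Tate1966Endomorphisms, Main Theorem] -/
theorem tate_end_bijective_of_finite_of_pseudoCoherent_general_of_poincare
    (h : cechComplex_pseudoCoherent_general.{u})
    (hP1 : ∀ (X Y : AbelianVariety K) (i : Y ⟶ X), IsClosedImmersion (Hom.toSchemeHom i) →
      0 < Y.dim → Y.dim < X.dim →
      ∃ (Z : AbelianVariety K) (j : Z ⟶ X), IsClosedImmersion (Hom.toSchemeHom j) ∧
        IsIsogeny (biprod.desc i j))
    (hsimple : ∀ (X Y : AbelianVariety K), IsSimple X → IsSimple Y →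
      ∀ f : X ⟶ Y, f ≠ 0 → IsIsogeny f)
    (hfin : finite_isoClasses_of_finite K (A ⊞ A).dim) (hq : exists_quotient_isogeny (A ⊞ A) ℓ) :
    tate_end_bijective_of_finite A ℓ :=
  tate_end_bijective_of_finite_of_theoremOfCube_of_poincare A ℓ
    (theoremOfCube_linEquiv_of_pseudoCoherent_general h) hP1 hsimple hfin hq

/-- **Tate 1966, Main Theorem (`End` form), from the Theorem of the Cube, `hsimple` and
Poincaré's theorem in two-sided splitting form** (`hP`: a non-simple `X` admits isogenies
`X₁ ⊞ X₂ → X`, `X → X₁ ⊞ X₂` with `dim Xᵢ < dim X`; Mumford §19 Thm. 1 with Cor. 1):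
`End_K(A)` finitely generated by `module_finite_hom_of_theoremOfCube_of_isogeny_biprod`, `End⁰(A)`
semisimple by `isSemisimpleRing_endAlgebra_of_poincare`. [cite: Tate1966Endomorphisms, Main Theorem] -/
theorem tate_end_bijective_of_finite_of_theoremOfCube_of_isogeny_biprod
    (hcube : theoremOfCube_linEquiv.{u})
    (hsimple : ∀ (X Y : AbelianVariety K), IsSimple X → IsSimple Y →
      ∀ f : X ⟶ Y, f ≠ 0 → IsIsogeny f)
    (hP : ∀ X : AbelianVariety K, ¬ IsSimple X → ∃ X₁ X₂ : AbelianVariety K,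
      X₁.dim < X.dim ∧ X₂.dim < X.dim ∧ (∃ σ : X₁ ⊞ X₂ ⟶ X, IsIsogeny σ) ∧
        ∃ τ : X ⟶ X₁ ⊞ X₂, IsIsogeny τ)
    (hfin : finite_isoClasses_of_finite K (A ⊞ A).dim) (hq : exists_quotient_isogeny (A ⊞ A) ℓ) :
    tate_end_bijective_of_finite A ℓ :=
  have hfg : module_finite_hom A A :=
    module_finite_hom_of_theoremOfCube_of_isogeny_biprod hcube hsimple hP A A
  tate_end_bijective_of_finite_of_endAlgebra A ℓ hfin hq
    (finiteDimensional_endAlgebra_of_module_finite_hom A hfg)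
    (isSemisimpleRing_endAlgebra_of_poincare hsimple hP A)
    (faltingsTateMap_injective_of_module_finite_hom A A hfg)

/-- **Tate 1966, Main Theorem (`Hom` form), from the Theorem of the Cube, Poincaré's complete
reducibility theorem and "simple ⇒ isogeny".** The named fact `tate_bijective_of_finite A B ℓ`
(for `K` finite and `(ℓ : K) ≠ 0`, `ℤ_ℓ ⊗ Hom_K(A, B) → Hom_{Γ_K}(T_ℓ A, T_ℓ B)` is bijective)
follows from `hcube`, `hP1`, `hsimple`, `finite_isoClasses_of_finite K (dim (A ⊞ B))` and
`exists_quotient_isogeny (A ⊞ B) ℓ`: `End_K(A ⊞ B)` is finitely generated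
(`module_finite_hom_of_theoremOfCube_of_poincare`, Mumford §19 Thm. 3) and `End⁰(A ⊞ B)` is
semisimple (`isSemisimpleRing_endAlgebra_of_mumford19`, §19 Cor. 2 of Thm. 1); conclude by
`tate_bijective_of_finite_of_endAlgebra_of_module_finite_hom` (Tate's theorem for `A × B`
restricted to the corner `Hom(A, B)`). [cite: Tate1966Endomorphisms, Main Theorem] -/
theorem tate_bijective_of_finite_of_theoremOfCube_of_poincare
    (hcube : theoremOfCube_linEquiv.{u})
    (hP1 : ∀ (X Y : AbelianVariety K) (i : Y ⟶ X), IsClosedImmersion (Hom.toSchemeHom i) →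
      0 < Y.dim → Y.dim < X.dim →
      ∃ (Z : AbelianVariety K) (j : Z ⟶ X), IsClosedImmersion (Hom.toSchemeHom j) ∧
        IsIsogeny (biprod.desc i j))
    (hsimple : ∀ (X Y : AbelianVariety K), IsSimple X → IsSimple Y →
      ∀ f : X ⟶ Y, f ≠ 0 → IsIsogeny f)
    (hfin : finite_isoClasses_of_finite K (A ⊞ B).dim) (hq : exists_quotient_isogeny (A ⊞ B) ℓ) :
    tate_bijective_of_finite A B ℓ :=
  tate_bijective_of_finite_of_endAlgebra_of_module_finite_hom A B ℓ hfin hq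
    (isSemisimpleRing_endAlgebra_of_mumford19 hP1 hsimple (A ⊞ B))
    (module_finite_hom_of_theoremOfCube_of_poincare hcube hP1 hsimple (A ⊞ B) (A ⊞ B))

/-- **Tate 1966, Main Theorem (`Hom` form) — the current trust base in this tree**:
`tate_bijective_of_finite A B ℓ` from `cechComplex_pseudoCoherent_general` (Görtz–Wedhorn II,
Thm. 23.133 / Cor. 23.135), `hP1` (Mumford §19 Thm. 1), `hsimple` (§19 Cor. 2 of Thm. 1),
`finite_isoClasses_of_finite K (dim (A ⊞ B))` (Milne 1986 Cor. 18.9) and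
`exists_quotient_isogeny (A ⊞ B) ℓ` (Mumford §7 Thm. 4). Granted the discharges of the three named
facts and proofs of `hP1`, `hsimple`, `tate_bijective_of_finite_holds` is this theorem applied to
them. [cite: Tate1966Endomorphisms, Main Theorem] -/
theorem tate_bijective_of_finite_of_pseudoCoherent_general_of_poincare
    (h : cechComplex_pseudoCoherent_general.{u})
    (hP1 : ∀ (X Y : AbelianVariety K) (i : Y ⟶ X), IsClosedImmersion (Hom.toSchemeHom i) →
      0 < Y.dim → Y.dim < X.dim →
      ∃ (Z : AbelianVariety K) (j : Z ⟶ X), IsClosedImmersion (Hom.toSchemeHom j) ∧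
        IsIsogeny (biprod.desc i j))
    (hsimple : ∀ (X Y : AbelianVariety K), IsSimple X → IsSimple Y →
      ∀ f : X ⟶ Y, f ≠ 0 → IsIsogeny f)
    (hfin : finite_isoClasses_of_finite K (A ⊞ B).dim) (hq : exists_quotient_isogeny (A ⊞ B) ℓ) :
    tate_bijective_of_finite A B ℓ :=
  tate_bijective_of_finite_of_theoremOfCube_of_poincare A B ℓ
    (theoremOfCube_linEquiv_of_pseudoCoherent_general h) hP1 hsimple hfin hq

/-- **Tate 1966, Main Theorem (`Hom` form), from the Theorem of the Cube, `hsimple` and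
Poincaré's theorem in two-sided splitting form `hP`** (Mumford §19 Thm. 1 with Cor. 1):
`End_K(A ⊞ B)` finitely generated by `module_finite_hom_of_theoremOfCube_of_isogeny_biprod`, `End⁰(A ⊞ B)`
semisimple by `isSemisimpleRing_endAlgebra_of_poincare`. [cite: Tate1966Endomorphisms, Main Theorem] -/
theorem tate_bijective_of_finite_of_theoremOfCube_of_isogeny_biprod
    (hcube : theoremOfCube_linEquiv.{u})
    (hsimple : ∀ (X Y : AbelianVariety K), IsSimple X → IsSimple Y →
      ∀ f : X ⟶ Y, f ≠ 0 → IsIsogeny f)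
    (hP : ∀ X : AbelianVariety K, ¬ IsSimple X → ∃ X₁ X₂ : AbelianVariety K,
      X₁.dim < X.dim ∧ X₂.dim < X.dim ∧ (∃ σ : X₁ ⊞ X₂ ⟶ X, IsIsogeny σ) ∧
        ∃ τ : X ⟶ X₁ ⊞ X₂, IsIsogeny τ)
    (hfin : finite_isoClasses_of_finite K (A ⊞ B).dim) (hq : exists_quotient_isogeny (A ⊞ B) ℓ) :
    tate_bijective_of_finite A B ℓ :=
  tate_bijective_of_finite_of_endAlgebra_of_module_finite_hom A B ℓ hfin hq
    (isSemisimpleRing_endAlgebra_of_poincare hsimple hP (A ⊞ B))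
    (module_finite_hom_of_theoremOfCube_of_isogeny_biprod hcube hsimple hP (A ⊞ B) (A ⊞ B))

/-- **Tate 1966, Main Theorem (`Hom` form) for all pairs, from the global forms of the inputs**:
the Theorem of the Cube, `hP1`, `hsimple`, finiteness of `K`-isomorphism classes in every
dimension (`∀ g, finite_isoClasses_of_finite K g`, Milne 1986 Cor. 18.9 as printed) and quotients
of every abelian variety over `K` (`∀ P, exists_quotient_isogeny P ℓ`) give
`tate_bijective_of_finite A B ℓ` for all `A`, `B`
(`tate_bijective_of_finite_of_theoremOfCube_of_poincare`). [cite: Tate1966Endomorphisms, Main Theorem] -/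
theorem tate_bijective_of_finite_of_forall_theoremOfCube_of_poincare
    (hcube : theoremOfCube_linEquiv.{u})
    (hP1 : ∀ (X Y : AbelianVariety K) (i : Y ⟶ X), IsClosedImmersion (Hom.toSchemeHom i) →
      0 < Y.dim → Y.dim < X.dim →
      ∃ (Z : AbelianVariety K) (j : Z ⟶ X), IsClosedImmersion (Hom.toSchemeHom j) ∧
        IsIsogeny (biprod.desc i j))
    (hsimple : ∀ (X Y : AbelianVariety K), IsSimple X → IsSimple Y →
      ∀ f : X ⟶ Y, f ≠ 0 → IsIsogeny f)
    (hfin : ∀ g : ℕ, finite_isoClasses_of_finite K g)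
    (hq : ∀ P : AbelianVariety K, exists_quotient_isogeny P ℓ) (A B : AbelianVariety K) :
    tate_bijective_of_finite A B ℓ :=
  tate_bijective_of_finite_of_theoremOfCube_of_poincare A B ℓ hcube hP1 hsimple (hfin _) (hq _)

/-- **Tate 1966, Main Theorem (`Hom` form) for all pairs — the current trust base, global form**:
`cechComplex_pseudoCoherent_general`, `hP1`, `hsimple`, `∀ g, finite_isoClasses_of_finite K g` and
`∀ P, exists_quotient_isogeny P ℓ` give `tate_bijective_of_finite A B ℓ` for all `A`, `B`, and in
particular the `End` form `tate_end_bijective_of_finite A ℓ` (`tate_end_bijective_of_finite_of`).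
[cite: Tate1966Endomorphisms, Main Theorem] -/
theorem tate_bijective_of_finite_of_forall_pseudoCoherent_general_of_poincare
    (h : cechComplex_pseudoCoherent_general.{u})
    (hP1 : ∀ (X Y : AbelianVariety K) (i : Y ⟶ X), IsClosedImmersion (Hom.toSchemeHom i) →
      0 < Y.dim → Y.dim < X.dim →
      ∃ (Z : AbelianVariety K) (j : Z ⟶ X), IsClosedImmersion (Hom.toSchemeHom j) ∧
        IsIsogeny (biprod.desc i j))
    (hsimple : ∀ (X Y : AbelianVariety K), IsSimple X → IsSimple Y →
      ∀ f : X ⟶ Y, f ≠ 0 → IsIsogeny f)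
    (hfin : ∀ g : ℕ, finite_isoClasses_of_finite K g)
    (hq : ∀ P : AbelianVariety K, exists_quotient_isogeny P ℓ) (A B : AbelianVariety K) :
    tate_bijective_of_finite A B ℓ ∧ tate_end_bijective_of_finite A ℓ :=
  have hcube : theoremOfCube_linEquiv.{u} := theoremOfCube_linEquiv_of_pseudoCoherent_general h
  ⟨tate_bijective_of_finite_of_forall_theoremOfCube_of_poincare ℓ hcube hP1 hsimple hfin hq A B,
    tate_end_bijective_of_finite_of A ℓ
      (tate_bijective_of_finite_of_forall_theoremOfCube_of_poincare ℓ hcube hP1 hsimple hfin hq A A)⟩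

end Finite

/-! ## Faltings 1983, §5 over a number field -/

section NumberField

variable (A B : AbelianVariety K) (ℓ : ℕ) [Fact ℓ.Prime]

/-- **Faltings 1983, §5, Satz 4, from Finiteness I, quotients, the Theorem of the Cube and
Poincaré.** For an abelian variety `A` over a number field `K` and a prime `ℓ`, the Tate map
`ℤ_ℓ ⊗ End_K(A) → End_{Γ_K}(T_ℓ A)` is bijective (`faltings_tate_bijective A A ℓ`), granted
Finiteness I for `A ⊞ A` (`hfin`, named fact `finite_isoClasses_isogenous`, Faltings §6 Satz 6
with Zarhin's trick), quotients of `A ⊞ A` (`hq`), the Theorem of the Cube (`hcube`),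
Poincaré's theorem `hP1` and `hsimple` (Mumford §19 Thm. 1, Cor. 2): `End_K(A)` is finitely
generated by
`module_finite_hom_of_theoremOfCube_of_poincare` and `End⁰(A)` semisimple by
`isSemisimpleRing_endAlgebra_of_mumford19`; conclude by
`faltings_tate_end_bijective_of_finitenessI_of_endAlgebra_of_module_finite_hom` (Faltings'
"as in [16]"). This removes the inputs `hdeg`, `hA` of
`faltings_tate_end_bijective_of_finitenessI_of_mumford19`. [cite: Faltings1983Endlichkeit, §5 Satz 4] -/
theorem faltings_tate_end_bijective_of_finitenessI_of_theoremOfCube_of_poincare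
    (hfin : finite_isoClasses_isogenous (A ⊞ A)) (hq : exists_quotient_isogeny (A ⊞ A) ℓ)
    (hcube : theoremOfCube_linEquiv.{u})
    (hP1 : ∀ (X Y : AbelianVariety K) (i : Y ⟶ X), IsClosedImmersion (Hom.toSchemeHom i) →
      0 < Y.dim → Y.dim < X.dim →
      ∃ (Z : AbelianVariety K) (j : Z ⟶ X), IsClosedImmersion (Hom.toSchemeHom j) ∧
        IsIsogeny (biprod.desc i j))
    (hsimple : ∀ (X Y : AbelianVariety K), IsSimple X → IsSimple Y →
      ∀ f : X ⟶ Y, f ≠ 0 → IsIsogeny f) :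
    faltings_tate_bijective A A ℓ := by
  intro hK
  have h := faltings_tate_end_bijective_of_finitenessI_of_endAlgebra_of_module_finite_hom A ℓ hfin
    hq (isSemisimpleRing_endAlgebra_of_mumford19 hP1 hsimple A)
    (module_finite_hom_of_theoremOfCube_of_poincare hcube hP1 hsimple A A)
  exact h

/-- **Faltings 1983, §5, Korollar 1, from Finiteness I, quotients, the Theorem of the Cube and
Poincaré** ("Theorem 4 applied to `A₁ × A₂`"): `faltings_tate_bijective A B ℓ` from Finiteness I
and quotients for `(A ⊞ B) ⊞ (A ⊞ B)`, `hcube`, `hP1`, `hsimple`: Satz 4 for `A ⊞ B`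
(`faltings_tate_end_bijective_of_finitenessI_of_endAlgebra_of_module_finite_hom` with
`module_finite_hom_of_theoremOfCube_of_poincare` at `(A ⊞ B, A ⊞ B)` and
`isSemisimpleRing_endAlgebra_of_mumford19`) restricted to the corner `Hom(A, B)`
(`faltings_tate_bijective_of_end_biprod`). [cite: Faltings1983Endlichkeit, §5 Korollar 1] -/
theorem faltings_tate_bijective_of_finitenessI_of_theoremOfCube_of_poincare
    (hfin : finite_isoClasses_isogenous ((A ⊞ B) ⊞ (A ⊞ B)))
    (hq : exists_quotient_isogeny ((A ⊞ B) ⊞ (A ⊞ B)) ℓ)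
    (hcube : theoremOfCube_linEquiv.{u})
    (hP1 : ∀ (X Y : AbelianVariety K) (i : Y ⟶ X), IsClosedImmersion (Hom.toSchemeHom i) →
      0 < Y.dim → Y.dim < X.dim →
      ∃ (Z : AbelianVariety K) (j : Z ⟶ X), IsClosedImmersion (Hom.toSchemeHom j) ∧
        IsIsogeny (biprod.desc i j))
    (hsimple : ∀ (X Y : AbelianVariety K), IsSimple X → IsSimple Y →
      ∀ f : X ⟶ Y, f ≠ 0 → IsIsogeny f) :
    faltings_tate_bijective A B ℓ := by
  intro hK
  have h := faltings_tate_bijective_of_end_biprod A B ℓ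
    (faltings_tate_end_bijective_of_finitenessI_of_endAlgebra_of_module_finite_hom (A ⊞ B) ℓ hfin
      hq (isSemisimpleRing_endAlgebra_of_mumford19 hP1 hsimple (A ⊞ B))
      (module_finite_hom_of_theoremOfCube_of_poincare hcube hP1 hsimple (A ⊞ B) (A ⊞ B)))
  exact h

/-- **Faltings 1983, §5, Satz 3, from Finiteness I, quotients, the Theorem of the Cube and
Poincaré**: over a number field `V_ℓ A` is a semisimple `ℚ_ℓ[Γ_K]`-module
(`isSemisimpleRepresentation_rationalTateRep A ℓ`), granted Finiteness I and quotients for `A`,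
`hcube`, `hP1`, `hsimple`: `End_K(A)` finitely generated
(`module_finite_hom_of_theoremOfCube_of_poincare`), so `End⁰(A)` is finite-dimensional
(`finiteDimensional_endAlgebra_of_module_finite_hom`) and semisimple
(`isSemisimpleRing_endAlgebra_of_mumford19`); conclude by
`isSemisimpleRepresentation_rationalTateRep_of_finitenessI_of_endAlgebra`.
[cite: Faltings1983Endlichkeit, §5 Satz 3] -/
theorem isSemisimpleRepresentation_rationalTateRep_of_finitenessI_of_theoremOfCube_of_poincare
    (hfin : finite_isoClasses_isogenous A) (hq : exists_quotient_isogeny A ℓ)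
    (hcube : theoremOfCube_linEquiv.{u})
    (hP1 : ∀ (X Y : AbelianVariety K) (i : Y ⟶ X), IsClosedImmersion (Hom.toSchemeHom i) →
      0 < Y.dim → Y.dim < X.dim →
      ∃ (Z : AbelianVariety K) (j : Z ⟶ X), IsClosedImmersion (Hom.toSchemeHom j) ∧
        IsIsogeny (biprod.desc i j))
    (hsimple : ∀ (X Y : AbelianVariety K), IsSimple X → IsSimple Y →
      ∀ f : X ⟶ Y, f ≠ 0 → IsIsogeny f) :
    isSemisimpleRepresentation_rationalTateRep A ℓ := by
  intro hK
  have hfg : module_finite_hom A A :=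
    module_finite_hom_of_theoremOfCube_of_poincare hcube hP1 hsimple A A
  have h := isSemisimpleRepresentation_rationalTateRep_of_finitenessI_of_endAlgebra A ℓ hfin hq
    (finiteDimensional_endAlgebra_of_module_finite_hom A hfg)
    (isSemisimpleRing_endAlgebra_of_mumford19 hP1 hsimple A)
  exact h

/-- **Faltings 1983, §5, Korollar 1 for all pairs, from the global forms of the inputs**:
Finiteness I and quotients for every abelian variety over the number field `K`, the Theorem of
the Cube, `hP1` and `hsimple` give `faltings_tate_bijective X Y ℓ` for every pair
(`faltings_tate_bijective_of_finitenessI_of_theoremOfCube_of_poincare`).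
[cite: Faltings1983Endlichkeit, §5 Korollar 1] -/
theorem faltings_tate_bijective_of_forall_finitenessI_of_theoremOfCube_of_poincare
    (hfin : ∀ P : AbelianVariety K, finite_isoClasses_isogenous P)
    (hq : ∀ P : AbelianVariety K, exists_quotient_isogeny P ℓ)
    (hcube : theoremOfCube_linEquiv.{u})
    (hP1 : ∀ (X Y : AbelianVariety K) (i : Y ⟶ X), IsClosedImmersion (Hom.toSchemeHom i) →
      0 < Y.dim → Y.dim < X.dim →
      ∃ (Z : AbelianVariety K) (j : Z ⟶ X), IsClosedImmersion (Hom.toSchemeHom j) ∧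
        IsIsogeny (biprod.desc i j))
    (hsimple : ∀ (X Y : AbelianVariety K), IsSimple X → IsSimple Y →
      ∀ f : X ⟶ Y, f ≠ 0 → IsIsogeny f)
    (X Y : AbelianVariety K) : faltings_tate_bijective X Y ℓ :=
  faltings_tate_bijective_of_finitenessI_of_theoremOfCube_of_poincare X Y ℓ (hfin _) (hq _) hcube
    hP1 hsimple

/-- **Faltings 1983, §5, Korollar 2, (i) ⇔ (ii), from the global forms of the inputs**: two
abelian varieties `A`, `B` over a number field are `K`-isogenous iff `V_ℓ A ≅ V_ℓ B` as
`ℚ_ℓ[Γ_K]`-modules (`isIsogenous_iff_nonempty_equiv_rationalTateRep A B ℓ`), granted Finiteness I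
and quotients for every abelian variety over `K`, the Theorem of the Cube, `hP1` and `hsimple`:
Korollar 1 for all pairs (`faltings_tate_bijective_of_forall_finitenessI_of_theoremOfCube_of_poincare`)
and `isIsogenous_iff_nonempty_equiv_rationalTateRep_of_forall_faltings_tate_bijective`.
[cite: Faltings1983Endlichkeit, §5 Korollar 2] -/
theorem isIsogenous_iff_nonempty_equiv_rationalTateRep_of_finitenessI_of_theoremOfCube_of_poincare
    (hfin : ∀ P : AbelianVariety K, finite_isoClasses_isogenous P)
    (hq : ∀ P : AbelianVariety K, exists_quotient_isogeny P ℓ)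
    (hcube : theoremOfCube_linEquiv.{u})
    (hP1 : ∀ (X Y : AbelianVariety K) (i : Y ⟶ X), IsClosedImmersion (Hom.toSchemeHom i) →
      0 < Y.dim → Y.dim < X.dim →
      ∃ (Z : AbelianVariety K) (j : Z ⟶ X), IsClosedImmersion (Hom.toSchemeHom j) ∧
        IsIsogeny (biprod.desc i j))
    (hsimple : ∀ (X Y : AbelianVariety K), IsSimple X → IsSimple Y →
      ∀ f : X ⟶ Y, f ≠ 0 → IsIsogeny f) :
    isIsogenous_iff_nonempty_equiv_rationalTateRep A B ℓ :=
  isIsogenous_iff_nonempty_equiv_rationalTateRep_of_forall_faltings_tate_bijective A B ℓ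
    (faltings_tate_bijective_of_forall_finitenessI_of_theoremOfCube_of_poincare ℓ hfin hq hcube hP1
      hsimple)

end NumberField

/-! ## Tate's method over a perfect field: the Main Theorem from finiteness within an isogeny class -/

section PerfectField

variable {A B : AbelianVariety K} (ℓ : ℕ) [Fact ℓ.Prime]

/-- **Pigeonhole** (Milne, *Abelian Varieties* (2008), Ch. IV, proof of Lemma 2.4, p. 137: "at
least one class has infinitely many `B(n)`'s"): over a finite field, granted finitely many
`K`-isomorphism classes in dimension `g` (`finite_isoClasses_of_finite K g`, Milne 1986 Cor. 18.9),
every sequence of `g`-dimensional abelian varieties over `K` has an infinite set of mutually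
isomorphic terms (`Finite.exists_infinite_fiber`). [cite: MilneAV2008, Ch. IV, proof of Lemma 2.4, p. 137] -/
theorem AbelianVariety.exists_infinite_iso_of_finite_isoClasses_of_finite [Finite K] {g : ℕ}
    (h : finite_isoClasses_of_finite K g) (C : ℕ → AbelianVariety K) (hC : ∀ n, (C n).dim = g) :
    ∃ S : Set ℕ, S.Infinite ∧ ∀ m ∈ S, ∀ n ∈ S, Nonempty (C m ≅ C n) := by
  obtain ⟨k, D, hD⟩ := h
  choose i hi using fun n ↦ hD (C n) (hC n)
  obtain ⟨y, hy⟩ := Finite.exists_infinite_fiber i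
  refine ⟨i ⁻¹' {y}, Set.infinite_coe_iff.mp hy, fun m hm n hn ↦ ?_⟩
  have hm' : i m = y := hm
  have hn' : i n = y := hn
  exact ⟨(hi m).some ≪≫ eqToIso (by rw [hm', hn']) ≪≫ (hi n).some.symm⟩

/-- **(∞-iso) over a finite field**: granted `finite_isoClasses_of_finite K (dim P)`, in every
sequence of abelian varieties over the finite field `K` isogenous to `P` infinitely many terms are
mutually isomorphic — isogenous abelian varieties have the same dimension
(`dim_eq_of_isIsogenous_holds`, Mumford §7 App. 3) and
`exists_infinite_iso_of_finite_isoClasses_of_finite`. This is the hypothesis `hfin` of the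
perfect-field lattice lemma `tateSubspaceRealization_of_exists_infinite_iso`.
[cite: MilneAV2008, Ch. IV, proof of Lemma 2.4, p. 137] -/
theorem AbelianVariety.exists_infinite_iso_of_finite_isoClasses_of_finite_of_isIsogenous [Finite K]
    (P : AbelianVariety K) (h : finite_isoClasses_of_finite K P.dim) (C : ℕ → AbelianVariety K)
    (hC : ∀ n, IsIsogenous (C n) P) :
    ∃ S : Set ℕ, S.Infinite ∧ ∀ m ∈ S, ∀ n ∈ S, Nonempty (C m ≅ C n) :=
  exists_infinite_iso_of_finite_isoClasses_of_finite h C fun n ↦ dim_eq_of_isIsogenous_holds (hC n)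

/-- **Tate's method over a perfect field** (Tate 1966, §§1–3; Faltings 1983, §5 "as in [16]";
Milne, *Abelian Varieties* (2008), Ch. IV, Lemma 2.4 and Thm. 2.5). Let `K` be a perfect field,
`ℓ` a prime invertible in `K`, `b` a bicone on `(A, B)` with vertex `P = b.pt` (e.g. `A ⊞ B`).
Assume: (∞-iso) in every sequence of abelian varieties over `K` isogenous to `P` infinitely many
terms are mutually isomorphic (`hiso` — over a finite field a consequence of Milne 1986 Cor. 18.9,
over a number field of Finiteness I); `P` admits quotients by finite `Γ_K`-stable `ℓ`-power
subgroups (`hq`, Mumford §7 Thm. 4); `End⁰(P)` is finite-dimensional (`hfd`, Mumford §19 Cor. 1 of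
Thm. 3) and semisimple (`hss`, §19 Cor. 2 of Thm. 1); and the Tate map of `Hom_K(A, B)` at `ℓ` is
injective (`hinj`, §19 Thm. 3). Then `ℤ_ℓ ⊗ Hom_K(A, B) → Hom_{Γ_K}(T_ℓ A, T_ℓ B)` is bijective.
Proof: `T_ℓ P` is free of finite rank (`module_free_tateModule_holds`,
`module_finite_tateModule_of_cast_ne_zero`); the lattice lemma
(`tateSubspaceRealization_of_exists_infinite_iso` with the dictionary
`exists_isogeny_range_tateModuleMap_eq_of_quotient`) realises every `Γ_K`-stable subspace of
`V_ℓ P` as `u(V_ℓ P)`, `u ∈ E_ℓ(P)`; `E_ℓ(P)` is semisimple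
(`isSemisimpleRing_rationalEndSubalgebra_of_endAlgebra`), so the double-centraliser step
(`mem_span_rationalTateModuleMap_of_tateSubspaceRealization`) gives the `ℚ_ℓ`-statement, and
Milne's Lemma 12.6 (`exists_eq_nsmul_of_forall_smul_eq_zero`,
`saturated_span_tateModuleMap_of_divisible`) the `ℤ_ℓ`-statement
(`faltingsTateMap_surjective_of_span_of_saturated`). [cite: MilneAV2008, Ch. IV Lemma 2.4 and Thm. 2.5 (pp. 137–138)] -/
theorem faltingsTateMap_bijective_of_exists_infinite_iso [PerfectField K] (hℓ : (ℓ : K) ≠ 0)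
    (b : BinaryBicone A B)
    (hiso : ∀ C : ℕ → AbelianVariety K, (∀ n, IsIsogenous (C n) b.pt) →
      ∃ S : Set ℕ, S.Infinite ∧ ∀ m ∈ S, ∀ n ∈ S, Nonempty (C m ≅ C n))
    (hq : exists_quotient_isogeny b.pt ℓ) (hfd : finiteDimensional_endAlgebra b.pt)
    (hss : IsSemisimpleRing (endAlgebra b.pt)) (hinj : Function.Injective (faltingsTateMap A B ℓ)) :
    Function.Bijective (faltingsTateMap A B ℓ) := by
  have hfinT : module_finite_tateModule b.pt ℓ := module_finite_tateModule_of_cast_ne_zero b.pt ℓ hℓ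
  have hW : tateSubspaceRealization b.pt ℓ :=
    tateSubspaceRealization_of_exists_infinite_iso b.pt ℓ hℓ hiso
      (exists_isogeny_range_tateModuleMap_eq_of_quotient b.pt ℓ hq) (module_free_tateModule_holds b.pt ℓ)
      hfinT
  refine ⟨hinj, faltingsTateMap_surjective_of_span_of_saturated ℓ
    (mem_span_rationalTateModuleMap_of_tateSubspaceRealization ℓ b hW
      (isSemisimpleRing_rationalEndSubalgebra_of_endAlgebra b.pt ℓ hfd hss) hfinT)
    fun t d hd ht ↦ saturated_span_tateModuleMap_of_divisible ℓ hℓ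
      (fun φ hφ ↦ exists_eq_nsmul_of_forall_smul_eq_zero ℓ hℓ φ hφ) t d hd ht⟩

/-- **Tate's method over a perfect field, with the Mumford §19 inputs from the Theorem of the
Cube, Poincaré's complete reducibility theorem and "simple ⇒ isogeny"**: for `K` perfect,
`(ℓ : K) ≠ 0`, (∞-iso) for `A ⊞ B` and quotients of `A ⊞ B`, the Tate map of `Hom_K(A, B)` at `ℓ`
is bijective — `End_K(A ⊞ B)` is finitely generated (`module_finite_hom_of_theoremOfCube_of_poincare`,
§19 Thm. 3), hence `Hom_K(A, B)` is (`module_finite_hom_of_module_finite_end_biprod`) and the Tate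
map is injective (`faltingsTateMap_injective_of_module_finite_hom`), `End⁰(A ⊞ B)` is
finite-dimensional (`finiteDimensional_endAlgebra_of_module_finite_hom`) and semisimple
(`isSemisimpleRing_endAlgebra_of_mumford19`); conclude by
`faltingsTateMap_bijective_of_exists_infinite_iso` for the bicone `A ⊞ B`.
[cite: MilneAV2008, Ch. IV Lemma 2.4 and Thm. 2.5 (pp. 137–138)] -/
theorem faltingsTateMap_bijective_of_exists_infinite_iso_of_theoremOfCube_of_poincare
    [PerfectField K] (hℓ : (ℓ : K) ≠ 0) (hcube : theoremOfCube_linEquiv.{u})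
    (hP1 : ∀ (X Y : AbelianVariety K) (i : Y ⟶ X), IsClosedImmersion (Hom.toSchemeHom i) →
      0 < Y.dim → Y.dim < X.dim →
      ∃ (Z : AbelianVariety K) (j : Z ⟶ X), IsClosedImmersion (Hom.toSchemeHom j) ∧
        IsIsogeny (biprod.desc i j))
    (hsimple : ∀ (X Y : AbelianVariety K), IsSimple X → IsSimple Y →
      ∀ f : X ⟶ Y, f ≠ 0 → IsIsogeny f)
    (A B : AbelianVariety K)
    (hiso : ∀ C : ℕ → AbelianVariety K, (∀ n, IsIsogenous (C n) (A ⊞ B)) →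
      ∃ S : Set ℕ, S.Infinite ∧ ∀ m ∈ S, ∀ n ∈ S, Nonempty (C m ≅ C n))
    (hq : exists_quotient_isogeny (A ⊞ B) ℓ) :
    Function.Bijective (faltingsTateMap A B ℓ) :=
  have hfg : module_finite_hom (A ⊞ B) (A ⊞ B) :=
    module_finite_hom_of_theoremOfCube_of_poincare hcube hP1 hsimple (A ⊞ B) (A ⊞ B)
  faltingsTateMap_bijective_of_exists_infinite_iso ℓ hℓ (BinaryBiproduct.bicone A B) hiso hq
    (finiteDimensional_endAlgebra_of_module_finite_hom (A ⊞ B) hfg)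
    (isSemisimpleRing_endAlgebra_of_mumford19 hP1 hsimple (A ⊞ B))
    (faltingsTateMap_injective_of_module_finite_hom A B
      (module_finite_hom_of_module_finite_end_biprod hfg) ℓ hℓ)

variable (A B)

/-- **Tate 1966, Main Theorem (`Hom` form), from finiteness of isomorphism classes within the
isogeny class of `A ⊞ B` only.** The named fact `tate_bijective_of_finite A B ℓ` follows from
(∞-iso) for `A ⊞ B` (in place of Milne 1986 Cor. 18.9 for all abelian varieties of dimension
`dim (A ⊞ B)`), quotients of `A ⊞ B`, `End⁰(A ⊞ B)` finite-dimensional and semisimple, and the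
injectivity of the Tate map — `faltingsTateMap_bijective_of_exists_infinite_iso` over the perfect
field `K` (`PerfectField.ofFinite`). [cite: Tate1966Endomorphisms, Main Theorem] -/
theorem tate_bijective_of_finite_of_exists_infinite_iso
    (hiso : ∀ [Finite K], ∀ C : ℕ → AbelianVariety K, (∀ n, IsIsogenous (C n) (A ⊞ B)) →
      ∃ S : Set ℕ, S.Infinite ∧ ∀ m ∈ S, ∀ n ∈ S, Nonempty (C m ≅ C n))
    (hq : exists_quotient_isogeny (A ⊞ B) ℓ) (hfd : finiteDimensional_endAlgebra (A ⊞ B))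
    (hss : IsSemisimpleRing (endAlgebra (A ⊞ B))) (hinj : faltingsTateMap_injective A B) :
    tate_bijective_of_finite A B ℓ := by
  intro _ hℓ
  haveI : PerfectField K := PerfectField.ofFinite
  exact faltingsTateMap_bijective_of_exists_infinite_iso ℓ hℓ (BinaryBiproduct.bicone A B) hiso hq
    hfd hss (hinj ℓ hℓ)

/-- **Tate 1966, Main Theorem (`End` form), from finiteness of isomorphism classes within the
isogeny class of `A ⊞ A` only**: `tate_end_bijective_of_finite A ℓ` from (∞-iso) for `A ⊞ A`,
quotients of `A ⊞ A`, `End⁰(A ⊞ A)` finite-dimensional and semisimple, and injectivity of the Tate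
map of `End_K(A)` (`tate_bijective_of_finite_of_exists_infinite_iso` with
`tate_end_bijective_of_finite_of`). [cite: Tate1966Endomorphisms, Main Theorem] -/
theorem tate_end_bijective_of_finite_of_exists_infinite_iso
    (hiso : ∀ [Finite K], ∀ C : ℕ → AbelianVariety K, (∀ n, IsIsogenous (C n) (A ⊞ A)) →
      ∃ S : Set ℕ, S.Infinite ∧ ∀ m ∈ S, ∀ n ∈ S, Nonempty (C m ≅ C n))
    (hq : exists_quotient_isogeny (A ⊞ A) ℓ) (hfd : finiteDimensional_endAlgebra (A ⊞ A))
    (hss : IsSemisimpleRing (endAlgebra (A ⊞ A))) (hinj : faltingsTateMap_injective A A) :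
    tate_end_bijective_of_finite A ℓ :=
  tate_end_bijective_of_finite_of A ℓ
    (tate_bijective_of_finite_of_exists_infinite_iso A A ℓ hiso hq hfd hss hinj)

/-- **Tate 1966, Main Theorem (`Hom` form), from (∞-iso) for `A ⊞ B`, quotients, the Theorem of
the Cube, Poincaré and "simple ⇒ isogeny"** — the finest form of the finiteness input consumed by
Tate's proof: finitely many `K`-isomorphism classes among the abelian varieties isogenous to
`A ⊞ B` (pigeonhole form), rather than among all of dimension `dim (A ⊞ B)`.
`faltingsTateMap_bijective_of_exists_infinite_iso_of_theoremOfCube_of_poincare` over the perfect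
field `K`. [cite: Tate1966Endomorphisms, Main Theorem] -/
theorem tate_bijective_of_finite_of_exists_infinite_iso_of_theoremOfCube_of_poincare
    (hcube : theoremOfCube_linEquiv.{u})
    (hP1 : ∀ (X Y : AbelianVariety K) (i : Y ⟶ X), IsClosedImmersion (Hom.toSchemeHom i) →
      0 < Y.dim → Y.dim < X.dim →
      ∃ (Z : AbelianVariety K) (j : Z ⟶ X), IsClosedImmersion (Hom.toSchemeHom j) ∧
        IsIsogeny (biprod.desc i j))
    (hsimple : ∀ (X Y : AbelianVariety K), IsSimple X → IsSimple Y →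
      ∀ f : X ⟶ Y, f ≠ 0 → IsIsogeny f)
    (hiso : ∀ [Finite K], ∀ C : ℕ → AbelianVariety K, (∀ n, IsIsogenous (C n) (A ⊞ B)) →
      ∃ S : Set ℕ, S.Infinite ∧ ∀ m ∈ S, ∀ n ∈ S, Nonempty (C m ≅ C n))
    (hq : exists_quotient_isogeny (A ⊞ B) ℓ) :
    tate_bijective_of_finite A B ℓ := by
  intro _ hℓ
  haveI : PerfectField K := PerfectField.ofFinite
  exact faltingsTateMap_bijective_of_exists_infinite_iso_of_theoremOfCube_of_poincare ℓ hℓ hcube hP1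
    hsimple A B hiso hq

/-- **Tate 1966, Main Theorem (`End` form), from (∞-iso) for `A ⊞ A`, quotients, the Theorem of
the Cube, Poincaré and "simple ⇒ isogeny"** (`…_of_theoremOfCube_of_poincare` for the pair
`(A, A)` with `tate_end_bijective_of_finite_of`). [cite: Tate1966Endomorphisms, Main Theorem] -/
theorem tate_end_bijective_of_finite_of_exists_infinite_iso_of_theoremOfCube_of_poincare
    (hcube : theoremOfCube_linEquiv.{u})
    (hP1 : ∀ (X Y : AbelianVariety K) (i : Y ⟶ X), IsClosedImmersion (Hom.toSchemeHom i) →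
      0 < Y.dim → Y.dim < X.dim →
      ∃ (Z : AbelianVariety K) (j : Z ⟶ X), IsClosedImmersion (Hom.toSchemeHom j) ∧
        IsIsogeny (biprod.desc i j))
    (hsimple : ∀ (X Y : AbelianVariety K), IsSimple X → IsSimple Y →
      ∀ f : X ⟶ Y, f ≠ 0 → IsIsogeny f)
    (hiso : ∀ [Finite K], ∀ C : ℕ → AbelianVariety K, (∀ n, IsIsogenous (C n) (A ⊞ A)) →
      ∃ S : Set ℕ, S.Infinite ∧ ∀ m ∈ S, ∀ n ∈ S, Nonempty (C m ≅ C n))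
    (hq : exists_quotient_isogeny (A ⊞ A) ℓ) :
    tate_end_bijective_of_finite A ℓ :=
  tate_end_bijective_of_finite_of A ℓ
    (tate_bijective_of_finite_of_exists_infinite_iso_of_theoremOfCube_of_poincare A A ℓ hcube hP1
      hsimple hiso hq)

/-- Consistency check: the perfect-field theorem recovers the finite-field assembly from Milne's
Cor. 18.9 — `tate_bijective_of_finite A B ℓ` from `finite_isoClasses_of_finite K (dim (A ⊞ B))`,
quotients of `A ⊞ B`, the Theorem of the Cube, `hP1` and `hsimple`, via
`exists_infinite_iso_of_finite_isoClasses_of_finite_of_isIsogenous` (same statement as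
`tate_bijective_of_finite_of_theoremOfCube_of_poincare`, obtained through
`faltingsTateMap_bijective_of_exists_infinite_iso`). [cite: Tate1966Endomorphisms, Main Theorem] -/
theorem tate_bijective_of_finite_of_theoremOfCube_of_poincare'
    (hcube : theoremOfCube_linEquiv.{u})
    (hP1 : ∀ (X Y : AbelianVariety K) (i : Y ⟶ X), IsClosedImmersion (Hom.toSchemeHom i) →
      0 < Y.dim → Y.dim < X.dim →
      ∃ (Z : AbelianVariety K) (j : Z ⟶ X), IsClosedImmersion (Hom.toSchemeHom j) ∧
        IsIsogeny (biprod.desc i j))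
    (hsimple : ∀ (X Y : AbelianVariety K), IsSimple X → IsSimple Y →
      ∀ f : X ⟶ Y, f ≠ 0 → IsIsogeny f)
    (hfin : finite_isoClasses_of_finite K (A ⊞ B).dim) (hq : exists_quotient_isogeny (A ⊞ B) ℓ) :
    tate_bijective_of_finite A B ℓ :=
  tate_bijective_of_finite_of_exists_infinite_iso_of_theoremOfCube_of_poincare A B ℓ hcube hP1 hsimple
    (fun C hC ↦ exists_infinite_iso_of_finite_isoClasses_of_finite_of_isIsogenous (A ⊞ B) hfin C hC)
    hq

end PerfectField

end Literature.AlgebraicGeometry.Motives
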